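import Mathlib
import Literature.Analysis.FluidPDE.BeltramiFlows
import Summits.NavierStokesRegularity.NavierStokesRegularity.Theorems.QuarterLogPincerLimitSilenceDefs
import Summits.NavierStokesRegularity.NavierStokesRegularity.Theorems.TypeIQuantSubcubicExp.Negative.SilencingCostBurnout
import HarnessLib

/-!
# Sc′ `ThickBoxSilencingCost`: the silencing constant is necessarily EXPONENTIALLY SMALL in `B²/δ` (tightness) — refuter lane ns-afl-r1

Supports crux stmt-NavierStokesRegularity-24077 (`QuarterLogPincer.TypeIQuantSubcubicExp`) via ns-idea-7's lines
`silencing_cost` v1.2 / `limit_silence` v1 (Sc′ = `LimitSilence.ThickBoxSilencingCost`, in the tree BY NAME: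
`…Theorems.QuarterLogPincerLimitSilenceDefs`).  NO Theses decl is asserted and Sc′ is neither proved nor refuted
(HONEST FRAME: 24077, W7 and Navier–Stokes regularity are OPEN).  This file is a TIGHTNESS LEMMA for provers: it
bounds from above every constant `c` that can appear in Sc′.

* `silencingConstant_le` — if `(K, c)` silences at `(B, δ, Γ₂)` in the sense of Sc′'s universal clause (verbatim)
  and `δ ≤ B²`, then `c ≤ 2·δ·K³·e^{−2B²/δ}`.  Witness: the exact caloric Beltrami mode
  `ω(s,x) = A e^{−s}·abc 0 1 0 (x)` (`∂ₛω = Δω`, `|abc 0 1 0| ≡ 1`, `2`-Lipschitz) at the scale `σ = B/√δ ≥ 1`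
  with `A = Bσ⁻³/2` (so `|ω| ≤ Bσ⁻²`, `‖∇ω‖ ≤ Bσ⁻³` hold): its centre enstrophy on `B(0,Γ₂σ)` is
  `(π/3)B²Γ₂³σ⁻³ ≥ δ/σ`, and after the admissible span `σ² = B²/δ` its enstrophy on `B(0,Kσ)` is
  `(π/3)δK³e^{−2B²/δ}/σ`.  So a gradient-capped mode of frequency `σ⁻¹·(B²/δ)^{1/2}` in box units burns the
  centre mass down by the factor `e^{−2B²/δ}` within one box span: ANY proof of Sc′ must produce a constant
  `c(B,δ,Γ₂,K) ≤ 2δK³e^{−2B²/δ}` — polynomial-loss energy arguments are excluded; only compactness / unique-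
  continuation-type arguments (which give no explicit `c`) are consistent with this bound.
* `not_silencing_of_large_constant` — the same, contrapositive: no pair `(K, c)` with `c > 2δK³e^{−2B²/δ}` silences.
-/

-- the summit and its single sub-problem share the name (CONVENTIONS §1), as in every Theorems file
set_option linter.dupNamespace false

namespace Summit.NavierStokesRegularity.NavierStokesRegularity.Theorems.TypeIQuantSubcubicExp.Negative.SilencingCost

noncomputable section

open MeasureTheory Set Function Filter Topology Metric Real
open scoped ENNReal NNReal Laplacian
open Literature.Analysis Literature.Analysis.FluidPDE

/-- **Sc′'s universal clause at `(B, K, δ, Γ₂, c)`** forces `c ≤ 2δK³e^{−2B²/δ}` whenever `δ ≤ B²` (the clause is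
copied VERBATIM from `LimitSilence.ThickBoxSilencingCost`; no definition is introduced). -/
theorem silencingConstant_le {B δ Γ₂ K c : ℝ} (hB : 1 ≤ B) (hδ : 0 < δ) (hδB : δ ≤ B ^ 2) (hΓ₂ : 1 ≤ Γ₂)
    (hK : Γ₂ ≤ K)
    (H : ∀ (ω : ℝ → (EuclideanSpace ℝ (Fin 3)) → (EuclideanSpace ℝ (Fin 3))) (y : (EuclideanSpace ℝ (Fin 3)))
      (σ t t₁ : ℝ), 0 < σ → t < t₁ → t₁ ≤ t + σ ^ 2 →
      IsSmoothSpaceTimeOn (Icc t t₁) ω →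
      (∀ s ∈ Icc t t₁, ∀ x ∈ ball y (2 * K * σ),
        ‖ω s x‖ ≤ B * σ ^ (-(2 : ℝ)) ∧ ‖fderiv ℝ (ω s) x‖ ≤ B * σ ^ (-(3 : ℝ)) ∧
        ‖timeDerivWithin (Icc t t₁) ω s x - (Δ (ω s)) x‖ ≤
          B * σ ^ (-(2 : ℝ)) * ‖ω s x‖ + B * σ ^ (-(1 : ℝ)) * ‖fderiv ℝ (ω s) x‖) →
      ENNReal.ofReal (δ / σ) ≤ ∫⁻ x in ball y (Γ₂ * σ), ‖ω t x‖ₑ ^ 2 →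
      ENNReal.ofReal (c / σ) ≤ ∫⁻ x in ball y (K * σ), ‖ω t₁ x‖ₑ ^ 2) :
    c ≤ 2 * δ * K ^ 3 * Real.exp (-(2 * B ^ 2 / δ)) := by
  have hB0 : 0 < B := by linarith
  have hK1 : 1 ≤ K := hΓ₂.trans hK
  have hK0 : 0 < K := by linarith
  -- the scale `σ = B/√δ ≥ 1`, `σ² = B²/δ`
  set S : ℝ := B ^ 2 / δ with hS_def
  have hS1 : 1 ≤ S := by rw [hS_def, le_div_iff₀ hδ]; linarith
  have hS0 : 0 < S := by linarith
  set σ : ℝ := Real.sqrt S with hσ_def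
  have hσ1 : 1 ≤ σ := Real.one_le_sqrt.2 hS1
  have hσ0 : 0 < σ := by linarith
  have hσsq : σ ^ 2 = S := Real.sq_sqrt hS0.le
  have hδσ : δ = B ^ 2 / σ ^ 2 := by rw [hσsq, hS_def]; field_simp
  have hq2 : σ ^ (-(2 : ℝ)) = (σ ^ 2)⁻¹ := by rw [Real.rpow_neg hσ0.le, Real.rpow_two]
  have hq3 : σ ^ (-(3 : ℝ)) = (σ ^ 3)⁻¹ := by
    rw [Real.rpow_neg hσ0.le, show (3 : ℝ) = ((3 : ℕ) : ℝ) by norm_num, Real.rpow_natCast]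
  have hq32 : σ ^ (-(3 : ℝ)) ≤ σ ^ (-(2 : ℝ)) :=
    Real.rpow_le_rpow_of_exponent_le hσ1 (by norm_num)
  have hq30 : 0 < σ ^ (-(3 : ℝ)) := Real.rpow_pos_of_pos hσ0 _
  -- the amplitude `A = Bσ⁻³/2`
  set A : ℝ := B * σ ^ (-(3 : ℝ)) / 2 with hA_def
  have hA0 : 0 < A := by positivity
  -- the witness
  set a : EuclideanSpace ℝ (Fin 3) → EuclideanSpace ℝ (Fin 3) := ABC.abc 0 1 0 with ha_def
  set ω : ℝ → EuclideanSpace ℝ (Fin 3) → EuclideanSpace ℝ (Fin 3) :=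
    fun s x => (A * Real.exp (-s)) • a x with hω_def
  have hnorm : ∀ s x, ‖ω s x‖ = A * Real.exp (-s) := by
    intro s x
    rw [hω_def]
    dsimp only
    rw [norm_smul, ha_def, norm_abc_shear, mul_one, Real.norm_eq_abs,
      abs_of_pos (mul_pos hA0 (Real.exp_pos _))]
  have key := H ω 0 σ 0 (σ ^ 2) hσ0 (by positivity) (by simp) ?_ ?_ ?_
  · -- read the conclusion: `c/σ ≤ (A e^{-σ²})²·(4π/3)(Kσ)³`
    rw [lintegral_ball_of_norm_const (ω (σ ^ 2)) _ (mul_pos hA0 (Real.exp_pos _)).le (hnorm _) 0 (K * σ)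
      (by positivity), ENNReal.ofReal_le_ofReal_iff (by positivity), div_le_iff₀ hσ0] at key
    -- `e^{-σ²}² = e^{-2B²/δ}`
    have hexp : Real.exp (-σ ^ 2) ^ 2 = Real.exp (-(2 * B ^ 2 / δ)) := by
      rw [← Real.exp_nat_mul]; congr 1; rw [hσsq, hS_def]; push_cast; ring
    have hE0 : 0 < Real.exp (-(2 * B ^ 2 / δ)) := Real.exp_pos _
    rw [mul_pow, hexp, hA_def, hq3] at key
    have hπ : π < 4 := Real.pi_lt_four
    have hBσ : B ^ 2 / σ ^ 2 = δ := hδσ.symm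
    -- key : c ≤ ((B (σ³)⁻¹/2)² · E) · ((Kσ)³ (4π/3)) · σ ; goal : c ≤ 2 δ K³ E
    have h1 : (B * (σ ^ 3)⁻¹ / 2) ^ 2 * Real.exp (-(2 * B ^ 2 / δ)) * ((K * σ) ^ 3 * (π * 4 / 3)) * σ
        = (π / 3) * (B ^ 2 / σ ^ 2) * K ^ 3 * Real.exp (-(2 * B ^ 2 / δ)) := by
      field_simp
      ring
    rw [h1, hBσ] at key
    have h2 : (π / 3) * δ * K ^ 3 * Real.exp (-(2 * B ^ 2 / δ)) ≤
        2 * δ * K ^ 3 * Real.exp (-(2 * B ^ 2 / δ)) := by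
      have hpos : 0 ≤ δ * K ^ 3 * Real.exp (-(2 * B ^ 2 / δ)) := by positivity
      nlinarith
    exact key.trans h2
  · -- joint smoothness on `[0,σ²] × ℝ³`
    change ContDiffOn ℝ _ (uncurry ω) _
    refine ContDiff.contDiffOn ?_
    have h1 : ContDiff ℝ ((⊤ : ℕ∞) : WithTop ℕ∞) fun p : ℝ × EuclideanSpace ℝ (Fin 3) =>
        A * Real.exp (-p.1) :=
      contDiff_const.mul (Real.contDiff_exp.comp contDiff_fst.neg)
    have h2 : ContDiff ℝ ((⊤ : ℕ∞) : WithTop ℕ∞) fun p : ℝ × EuclideanSpace ℝ (Fin 3) => a p.2 :=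
      (ABC.contDiff_abc 0 1 0).comp contDiff_snd
    exact h1.smul h2
  · -- the thick box bounds: `|ω| ≤ A ≤ Bσ⁻²`, `‖∇ω‖ ≤ 2A = Bσ⁻³`, `∂ₛω − Δω = 0`
    intro s hs x _
    have hes : Real.exp (-s) ≤ 1 := Real.exp_le_one_iff.2 (by linarith [hs.1])
    have hAe : 0 ≤ A * Real.exp (-s) := (mul_pos hA0 (Real.exp_pos _)).le
    refine ⟨?_, ?_, ?_⟩
    · rw [hnorm]
      calc A * Real.exp (-s) ≤ A := by nlinarith
        _ ≤ B * σ ^ (-(3 : ℝ)) := by rw [hA_def]; nlinarith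
        _ ≤ B * σ ^ (-(2 : ℝ)) := mul_le_mul_of_nonneg_left hq32 hB0.le
    · have hL := lipschitzWith_smul_abc_shear hAe
      have hfd : ‖fderiv ℝ (ω s) x‖ ≤ Real.toNNReal (2 * (A * Real.exp (-s))) := by
        have := norm_fderiv_le_of_lipschitz ℝ hL (x₀ := x)
        simpa [hω_def] using this
      rw [Real.coe_toNNReal _ (by positivity)] at hfd
      calc ‖fderiv ℝ (ω s) x‖ ≤ 2 * (A * Real.exp (-s)) := hfd
        _ ≤ 2 * A := by nlinarith
        _ = B * σ ^ (-(3 : ℝ)) := by rw [hA_def]; ring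
    · have hσ2pos : (0 : ℝ) < σ ^ 2 := by positivity
      have hderiv : timeDerivWithin (Icc 0 (σ ^ 2)) ω s x = (A * (Real.exp (-s) * -1)) • a x := by
        have hd : HasDerivAt (fun s' : ℝ => ω s' x) ((A * (Real.exp (-s) * -1)) • a x) s := by
          have := ((hasDerivAt_neg s).exp.const_mul A).smul_const (a x)
          simpa [hω_def] using this
        rw [timeDerivWithin]
        exact hd.hasDerivWithinAt.derivWithin (uniqueDiffOn_Icc hσ2pos s hs)
      have hlap : (Δ (ω s)) x = (A * Real.exp (-s)) • (-a x) := by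
        have e1 : ω s = (A * Real.exp (-s)) • a := by
          funext z; rfl
        rw [e1, InnerProductSpace.laplacian_smul _ ((ABC.contDiff_abc 0 1 0).contDiffAt (n := 2)), ha_def,
          ABC.laplacian_abc]
      rw [hderiv, hlap]
      have : (A * (Real.exp (-s) * -1)) • a x - (A * Real.exp (-s)) • -a x = 0 := by
        rw [smul_neg, sub_neg_eq_add, ← add_smul]
        have : A * (Real.exp (-s) * -1) + A * Real.exp (-s) = 0 := by ring
        rw [this, zero_smul]
      rw [this, norm_zero]
      positivity
  · -- the initial centre enstrophy on `B(0,Γ₂σ)`: `A²·(4π/3)(Γ₂σ)³ ≥ δ/σ`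
    rw [lintegral_ball_of_norm_const (ω 0) A hA0.le
      (fun x => by rw [hnorm, neg_zero, Real.exp_zero, mul_one]) 0 (Γ₂ * σ) (by positivity)]
    refine ENNReal.ofReal_le_ofReal ?_
    rw [hδσ, hA_def, hq3]
    have hπ : 3 < π := Real.pi_gt_three
    have hΓ3 : 1 ≤ Γ₂ ^ 3 := one_le_pow₀ hΓ₂
    have hσ3 : σ ^ 3 ≠ 0 := by positivity
    have e : (B * (σ ^ 3)⁻¹ / 2) ^ 2 * ((Γ₂ * σ) ^ 3 * (π * 4 / 3)) = (π / 3 * Γ₂ ^ 3) * (B ^ 2 / σ ^ 2 / σ) := by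
      field_simp
      ring
    rw [e]
    have hone : 1 ≤ π / 3 * Γ₂ ^ 3 := by
      have : 1 ≤ π / 3 := by rw [le_div_iff₀ (by norm_num : (0:ℝ) < 3)]; linarith
      nlinarith
    exact le_mul_of_one_le_left (by positivity) hone

/-- **Contrapositive**: no pair `(K, c)` with `c > 2δK³e^{−2B²/δ}` can silence at `(B, δ, Γ₂)` (`δ ≤ B²`). -/
theorem not_silencing_of_large_constant {B δ Γ₂ K c : ℝ} (hB : 1 ≤ B) (hδ : 0 < δ) (hδB : δ ≤ B ^ 2)
    (hΓ₂ : 1 ≤ Γ₂) (hK : Γ₂ ≤ K) (hc : 2 * δ * K ^ 3 * Real.exp (-(2 * B ^ 2 / δ)) < c) :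
    ¬ ∀ (ω : ℝ → (EuclideanSpace ℝ (Fin 3)) → (EuclideanSpace ℝ (Fin 3))) (y : (EuclideanSpace ℝ (Fin 3)))
      (σ t t₁ : ℝ), 0 < σ → t < t₁ → t₁ ≤ t + σ ^ 2 →
      IsSmoothSpaceTimeOn (Icc t t₁) ω →
      (∀ s ∈ Icc t t₁, ∀ x ∈ ball y (2 * K * σ),
        ‖ω s x‖ ≤ B * σ ^ (-(2 : ℝ)) ∧ ‖fderiv ℝ (ω s) x‖ ≤ B * σ ^ (-(3 : ℝ)) ∧
        ‖timeDerivWithin (Icc t t₁) ω s x - (Δ (ω s)) x‖ ≤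
          B * σ ^ (-(2 : ℝ)) * ‖ω s x‖ + B * σ ^ (-(1 : ℝ)) * ‖fderiv ℝ (ω s) x‖) →
      ENNReal.ofReal (δ / σ) ≤ ∫⁻ x in ball y (Γ₂ * σ), ‖ω t x‖ₑ ^ 2 →
      ENNReal.ofReal (c / σ) ≤ ∫⁻ x in ball y (K * σ), ‖ω t₁ x‖ₑ ^ 2 :=
  fun H => not_le.2 hc (silencingConstant_le hB hδ hδB hΓ₂ hK H)

open Summit.NavierStokesRegularity.NavierStokesRegularity.Cruxes.TypeIQuantSubcubicExp.LimitSilence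
  (ThickBoxSilencingCost) in
/-- **By-name link** (logically weak — it only CERTIFIES that the clause of `silencingConstant_le` is the matrix of
Sc′ `LimitSilence.ThickBoxSilencingCost` verbatim): under Sc′, the pair `(K, c)` it provides at `(B, δ, Γ₂)` with
`δ ≤ B²` obeys `c ≤ 2δK³e^{−2B²/δ}`. -/
theorem thickBoxSilencingCost_constant_le (h : ThickBoxSilencingCost) {B δ Γ₂ : ℝ} (hB : 1 ≤ B) (hδ : 0 < δ)
    (hδB : δ ≤ B ^ 2) (hΓ₂ : 1 ≤ Γ₂) :
    ∃ K c : ℝ, Γ₂ ≤ K ∧ 0 < c ∧ c ≤ δ ∧ c ≤ 2 * δ * K ^ 3 * Real.exp (-(2 * B ^ 2 / δ)) := by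
  obtain ⟨K, c, hK, hc, hcδ, H⟩ := h B δ Γ₂ hB hδ hΓ₂
  exact ⟨K, c, hK, hc, hcδ, silencingConstant_le hB hδ hδB hΓ₂ hK H⟩

end

end Summit.NavierStokesRegularity.NavierStokesRegularity.Theorems.TypeIQuantSubcubicExp.Negative.SilencingCost
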